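import Literature.Probability.RandomPlanarGeometry.BackwardLoewnerFlow
import Literature.Probability.RandomPlanarGeometry.SLETransienceZeroOne
import Literature.Probability.RandomPlanarGeometry.SLEDerivativeEstimates
import HarnessLib

/-!
# Rohde–Schramm's Lemma 3.1, pathwise: `f̂ₜ - ξ(t)` is the backward flow of the reversed driver

Trunk T-STOCH; a step towards Rohde–Schramm's derivative estimate Cor. 3.5
(`Literature.Probability.RandomPlanarGeometry.RohdeSchramm2005_cor35`). Rohde–Schramm, *Basic
properties of SLE*, Ann. Math. 161 (2005), Lemma 3.1 (p. 889): "for all fixed `t` the map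
`z ↦ g₋ₜ(z)` has the same distribution as `z ↦ f̂ₜ(z) - ξ(t)`", proved from the observation that
`ĝ_s(z) := g_{t+s} ∘ gₜ⁻¹(z + ξ(t)) - ξ(t)` solves Loewner's equation with the driver
`ξ̂ₜ(s) = ξ(t + s) - ξ(t)` and `ĝ₋ₜ = f̂ₜ - ξ(t)`. This file proves the **deterministic identity**
underlying it, for every continuous driving function `W` and every `z ∈ ℍ`:

* translating the driver translates `fₜ = gₜ⁻¹` (`Loewner.loewnerInv_add_const`, tree);
* `Loewner.fHat_sub_eq_bwdFlow` — `f̂ₜ(z) - W t = hₜ(z)`, the backward Loewner flow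
  (`Loewner.bwdFlow`, `BackwardLoewnerFlow.lean`) at time `t` of `z` driven by the reversed,
  recentred driver `U(s) = W(t - s) - W(t)` (`Loewner.revDriver (W - W t) t`);
* `Loewner.deriv_fHat_eq_deriv_bwdFlow` — hence `f̂ₜ'(z) = hₜ'(z)`, so that all the backward-flow
  identities of `BackwardLoewnerFlow` (`|hₜ'| = exp ∫ Re(2/Z²)`, `ψ ≤ 1`, …) apply to `f̂ₜ'`.

The distributional statement then only needs that the reversed Brownian motion
`s ↦ B(t - s) - B(t)` is a Brownian motion on `[0, t]` (elsewhere).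

## References

* S. Rohde, O. Schramm, *Basic properties of SLE*, Ann. of Math. 161 (2005), Lemma 3.1 and its
  proof (p. 889), §2.1 (`f̂ₜ(z) = fₜ(z + ξ(t))`, p. 887).
* G. F. Lawler, *Conformally Invariant Processes in the Plane*, AMS (2005), Ch. 4 §4.1, Rem. 4.8.
-/

noncomputable section

open Set Filter Topology Metric Complex
open UpperHalfPlane (upperHalfPlaneSet isOpen_upperHalfPlaneSet)
open scoped NNReal

namespace Literature.Probability.RandomPlanarGeometry

namespace Loewner

variable {W : ℝ≥0 → ℝ} {z : ℂ}

/-! ### Translating the driving function translates `fₜ` -/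

/-- The recentred driver `W - W t` and the translation by `W t`: `fₜ^W(z + W t) = fₜ^{W - W t}(z) + W t`,
i.e. `f̂ₜ(z) = fₜ^{W - W t}(z) + W t`. Rohde–Schramm (2005), §2.1 and proof of Lemma 3.1.
[cite: RohdeSchramm2005, Lemma 3.1] -/
theorem fHat_eq_loewnerInv_sub_add (hW : Continuous W) (t : ℝ≥0) (hz : 0 < z.im) :
    fHat W t z = loewnerInv (fun u ↦ W u - W t) t z + W t := by
  have hWc : Continuous fun u ↦ W u - W t := hW.sub continuous_const
  have h := loewnerInv_add_const hWc (W t) t hz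
  have hfun : (fun u ↦ W u - W t + W t) = W := funext fun u ↦ by ring
  rw [hfun] at h
  rw [fHat_apply, ← h]
  congr 1
  ring

/-! ### The backward solution of the recentred driver is the backward flow of the reversed driver -/

/-- For `V` continuous and `U = revDriver V t` (`U s = V (t - s)`), the tree's backward solution
`bwd V t z` from `z ∈ ℍ` coincides on `[0, t]` with the backward flow `u ↦ hᵤ(z)` driven by `U`:
both solve `ḣ(u) = -2/(h(u) - V(t - u))`, `h(0) = z` (uniqueness, `eqOn_of_backward`). [folklore] -/
theorem eqOn_bwd_bwdPath_revDriver {V : ℝ≥0 → ℝ} (hV : Continuous V) (t : ℝ≥0) (hz : 0 < z.im) :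
    EqOn (bwd V t z) (bwdPath (revDriver V t) z) (Icc (0 : ℝ) t) := by
  set U := revDriver V t with hU
  have hUc : Continuous U := continuous_revDriver hV t
  have hβ' := hasDerivWithinAt_bwd (continuous_revDriver hUc t) t hz
  have heq := eqOn_bwdPath_bwd hUc hz t
  -- the two backward fields agree on `[0, t]`
  have hfield : ∀ u ∈ Icc (0 : ℝ) t, ∀ x : ℂ,
      -vectorField (revDriver U t) ((t : ℝ) - u) x = -vectorField V ((t : ℝ) - u) x := by
    intro u hu x
    have hu' : u.toNNReal ≤ t := Real.toNNReal_le_iff_le_coe.2 hu.2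
    have h1 : ((t : ℝ) - u).toNNReal = t - u.toNNReal := by
      apply NNReal.eq
      rw [Real.coe_toNNReal _ (sub_nonneg.2 hu.2), NNReal.coe_sub hu', Real.coe_toNNReal _ hu.1]
    rw [vectorField_apply, vectorField_apply, h1, revDriver_tsub U hu', hU, revDriver_apply]
  have hβ : ∀ u ∈ Icc (0 : ℝ) t, HasDerivWithinAt (bwdPath U z)
      (-vectorField V ((t : ℝ) - u) (bwdPath U z u)) (Icc (0 : ℝ) t) u := by
    intro u hu
    have h1 := (hβ' u hu).congr (fun s hs ↦ (heq hs)) (heq hu)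
    rw [← heq hu, hfield u hu] at h1
    exact h1
  have hα := hasDerivWithinAt_bwd hV t hz
  refine eqOn_of_backward hα hβ (by rw [bwd_zero hV t hz]; exact hz) ?_
  rw [bwd_zero hV t hz, bwdPath_of_nonpos hUc hz le_rfl]

/-- `fₜ^V(z) = hₜ(z)` for the backward flow driven by `revDriver V t`. [cite: RohdeSchramm2005, Lemma 3.1] -/
theorem loewnerInv_eq_bwdFlow_revDriver {V : ℝ≥0 → ℝ} (hV : Continuous V) (t : ℝ≥0) (hz : 0 < z.im) :
    loewnerInv V t z = bwdFlow (revDriver V t) z t := by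
  rw [← bwd_self hV t hz, eqOn_bwd_bwdPath_revDriver hV t hz ⟨t.coe_nonneg, le_rfl⟩, bwdPath_coe]

/-! ### Lemma 3.1, pathwise -/

/-- The reversed, recentred driver of Rohde–Schramm's Lemma 3.1: `U(s) = W(t - s) - W(t)`
(`= ξ̂_t(-s)` in the notation of (3.7)). [cite: RohdeSchramm2005, Lemma 3.1] -/
def revCentredDriver (W : ℝ≥0 → ℝ) (t : ℝ≥0) : ℝ≥0 → ℝ := revDriver (fun u ↦ W u - W t) t

/-- Unfolding lemma for `revCentredDriver`. [folklore] -/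
@[simp] theorem revCentredDriver_apply (W : ℝ≥0 → ℝ) (t s : ℝ≥0) :
    revCentredDriver W t s = W (t - s) - W t := rfl

/-- The reversed recentred driver starts at `0`. [folklore] -/
theorem revCentredDriver_zero (W : ℝ≥0 → ℝ) (t : ℝ≥0) : revCentredDriver W t 0 = 0 := by simp

/-- The reversed recentred driver is continuous. [folklore] -/
theorem continuous_revCentredDriver (hW : Continuous W) (t : ℝ≥0) : Continuous (revCentredDriver W t) :=
  continuous_revDriver (hW.sub continuous_const) t

/-- **Rohde–Schramm's Lemma 3.1, pathwise**: `f̂ₜ(z) - W(t) = hₜ(z)`, the backward Loewner flow at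
time `t` of `z ∈ ℍ` driven by the reversed recentred driver `U(s) = W(t - s) - W(t)`.
(In the source: `ĝ₋ₜ₁(z) = f̂ₜ₁(z) - ξ(t₁)` where `ĝ` solves Loewner's equation driven by
`ξ̂ₜ₁(t) = ξ(t₁ + t) - ξ(t₁)`, p. 889.) [cite: RohdeSchramm2005, Lemma 3.1] -/
theorem fHat_sub_eq_bwdFlow (hW : Continuous W) (t : ℝ≥0) (hz : 0 < z.im) :
    fHat W t z - W t = bwdFlow (revCentredDriver W t) z t := by
  rw [fHat_eq_loewnerInv_sub_add hW t hz, add_sub_cancel_right]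
  exact loewnerInv_eq_bwdFlow_revDriver (V := fun u ↦ W u - W t) (hW.sub continuous_const) t hz

/-- Lemma 3.1 pathwise, additive form: `f̂ₜ(z) = hₜ(z) + W(t)`. [cite: RohdeSchramm2005, Lemma 3.1] -/
theorem fHat_eq_bwdFlow_add (hW : Continuous W) (t : ℝ≥0) (hz : 0 < z.im) :
    fHat W t z = bwdFlow (revCentredDriver W t) z t + W t := by
  rw [← fHat_sub_eq_bwdFlow hW t hz, sub_add_cancel]

/-- **`f̂ₜ' = hₜ'` on `ℍ`**: the derivative of `f̂ₜ` at `z ∈ ℍ` is the start-derivative of the backward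
flow of the reversed recentred driver (the identity `f̂ₜ = hₜ + W t` holds on the open set `ℍ`).
[cite: RohdeSchramm2005, Lemma 3.1] -/
theorem deriv_fHat_eq_deriv_bwdFlow (hW : Continuous W) (t : ℝ≥0) (hz : 0 < z.im) :
    deriv (fHat W t) z = deriv (fun w ↦ bwdFlow (revCentredDriver W t) w t) z := by
  have hev : fHat W t =ᶠ[𝓝 z] fun w ↦ bwdFlow (revCentredDriver W t) w t + W t := by
    filter_upwards [isOpen_upperHalfPlaneSet.mem_nhds hz] with w hw
    exact fHat_eq_bwdFlow_add hW t hw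
  rw [hev.deriv_eq]
  have hd := hasDerivAt_bwdFlow_start (continuous_revCentredDriver hW t) t hz
  rw [(hd.add_const (W t : ℂ)).deriv, hd.deriv]

/-- **`|f̂ₜ'(z)| = exp ∫₀ᵗ Re(2/Zᵤ²) du`** along the backward flow of the reversed recentred driver.
[cite: RohdeSchramm2005, eq. (3.9)] -/
theorem norm_deriv_fHat_eq (hW : Continuous W) (t : ℝ≥0) (hz : 0 < z.im) :
    ‖deriv (fHat W t) z‖ = Real.exp (∫ u in (0 : ℝ)..t, bwdLogDerivRate (revCentredDriver W t) z u) := by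
  rw [deriv_fHat_eq_deriv_bwdFlow hW t hz, norm_deriv_bwdFlow_start_eq (continuous_revCentredDriver hW t) t hz]

end Loewner

end Literature.Probability.RandomPlanarGeometry
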